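import Literature.Analysis.FluidPDE.PassiveVectorTensorDistorted
import Literature.Analysis.FluidPDE.PassiveVectorTensorTranslate
import HarnessLib

/-!
# Translation covariance of the CONSTANT-FRAME distorted weak passive-vector class

Analysis/FluidPDE proof-support file (everything proved; no new definitions, no named facts).

For a constant frame `G₀` (Armstrong–Vicol's Lagrangian-coordinate ansatz with the distortion frozen,
arXiv:2305.05048 §4.1) the distorted weak class `Torus.IsWeakTensorPassiveVectorDistortedOn A T 𝔸 b (fun _ _ => G₀) w₀ w`
(`PassiveVectorTensorDistorted` §5: constraint `∇·(G₀ w) = 0`, divergence-form test operator with the constant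
conjugated tensor `𝔸^{G₀}`, time-Lipschitz space-smooth tests with `∇·(G₀Ψ) = 0`) is TRANSLATION COVARIANT exactly
like the flat class (`PassiveVectorTensorTranslate`, `IsWeakTensorPassiveVectorOn.translate`): if `w` is a solution
along `b` from `w₀`, then `(t,y) ↦ w t (y + a)` is a solution along `(t,y) ↦ b t (y + a)` from `y ↦ w₀ (y + a)`.
Ingredients: the Haar measure of `T^d` is translation invariant; a CONSTANT matrix field commutes with translation
(`distort_const_translate`); the constant-coefficient divergence-form test operator is the flat one
(`viscAdjVar_const`) and commutes with translations (`viscAdj_translate`); and the time-Lipschitz test class is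
translation invariant (`IsLipschitzSpaceTimeTest.translate`, through `iterPartialDeriv_translate`).
This is step B1 of the port plan `HOME/ad-sawtooth-k1loc-p1/g16/W7thg-portplan-k1locp1g16.md` (cell `ad-ideate`,
K1L_D stmt-AnomalousDissipation-27980, registered producers `stub_D1_V0thg` / `stub_W7thg` of the frozen-frame graded
inputs (V_θg)/(W_θg)): with superposition (B2) and uniqueness (`…DistortedConstFrameUniqueness`) it gives the Bloch
SECTOR INVARIANCE of every constant-frame solution along a `(1/n)ℤ^d`-periodic carrier (B3, twin of
`PassiveVectorTensorSymmetry`).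

## Mathlib / tree search

Tree: `PassiveVectorTensorTranslate` (`liftAt/fderiv/partialDeriv/gradient/divergence/timeDeriv/stLift_translate`,
`IsDivFree.translate`, `IsWeaklyDivFree.translate`, `viscAdj_translate`, `measurePreserving_prod_add_right`,
flat `translate`), `PassiveVectorTensorDistorted` (`distort`, `viscAdjVar_const`, `IsLipschitzSpaceTimeTest`, the class),
`TorusDerivBounds` (`iterPartialDeriv`), `TorusCalculus` (`IsSmooth.comp_add_right`).  `rg translate
Literature/Analysis/FluidPDE/PassiveVectorTensorDistorted*.lean`: nothing (2026-08-29).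

## References

* S. Armstrong, V. Vicol, *Anomalous diffusion by fractal homogenization*, Ann. PDE 11 (2025) / arXiv:2305.05048, §4.1, PDF p. 34. [`ArmstrongVicol2025`]
* R. J. DiPerna, P.-L. Lions, Invent. Math. 98 (1989) 511–547, §II.1 (12)–(14) (weak solutions, test classes). [`DiPernaLions1989`]
* L. Grafakos, *Classical Fourier Analysis*, 3rd ed., GTM 249 (2014), §3.1 (translation on the torus). [`Grafakos2014`]
-/

noncomputable section

open MeasureTheory TopologicalSpace Set Function Filter Topology UnitAddTorus
open scoped ENNReal NNReal InnerProductSpace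

/-! ## §1 Iterated partial derivatives of translates -/

namespace Literature.Analysis.FunctionSpaces.Torus

/-- `∂^l (f(· + a)) x = ∂^l f (x + a)` for every multi-index word `l`. [cite: Grafakos2014, §3.1 (translation on the torus)] -/
theorem iterPartialDeriv_translate {d : Type*} [Fintype d] [DecidableEq d] {F : Type*} [NormedAddCommGroup F] [NormedSpace ℝ F]
    (l : List d) (f : UnitAddTorus d → F) (a : UnitAddTorus d) :
    iterPartialDeriv l (fun y => f (y + a)) = fun x => iterPartialDeriv l f (x + a) := by
  induction l with
  | nil => rfl
  | cons i l ih => rw [iterPartialDeriv_cons, iterPartialDeriv_cons, ih, partialDeriv_translate']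

end Literature.Analysis.FunctionSpaces.Torus

namespace Literature.Analysis.FluidPDE

namespace Torus

variable {d : Type*} [Fintype d] [DecidableEq d]

/-! ## §2 Constant frames commute with translations; the test class is translation invariant -/

omit [DecidableEq d] in
/-- A CONSTANT matrix field commutes with translation: `distort G₀ (v(· + a)) = (distort G₀ v)(· + a)`.
[cite: ArmstrongVicol2025, §4.1 (PDF p. 34)] -/
theorem distort_const_translate (G₀ : Matrix d d ℝ) (v : UnitAddTorus d → EuclideanSpace ℝ d) (a : UnitAddTorus d) :
    distort (fun _ => G₀) (fun y => v (y + a)) = fun y => distort (fun _ => G₀) v (y + a) := rfl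

/-- **Translates of time-Lipschitz space-smooth test fields are time-Lipschitz space-smooth test fields.**
[cite: DiPernaLions1989, §II.1 (12)–(14)] -/
theorem IsLipschitzSpaceTimeTest.translate {T : ℝ} {F : Type*} [NormedAddCommGroup F] [NormedSpace ℝ F]
    {ψ : ℝ → UnitAddTorus d → F} (hψ : IsLipschitzSpaceTimeTest T ψ) (a : UnitAddTorus d) :
    IsLipschitzSpaceTimeTest T (fun s y => ψ s (y + a)) where
  isSmooth_slice t := (hψ.isSmooth_slice t).comp_add_right a
  continuous_uncurry := hψ.continuous_uncurry.comp (continuous_fst.prodMk (continuous_snd.add continuous_const))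
  continuous_uncurry_partialDeriv j := by
    have e : (uncurry fun t y => FunctionSpaces.Torus.partialDeriv j (fun y => ψ t (y + a)) y)
        = (uncurry fun t y => FunctionSpaces.Torus.partialDeriv j (ψ t) y) ∘ fun p : ℝ × UnitAddTorus d => (p.1, p.2 + a) := by
      funext p; simp only [uncurry, Function.comp_apply, FunctionSpaces.Torus.partialDeriv_translate]
    rw [e]
    exact (hψ.continuous_uncurry_partialDeriv j).comp (continuous_fst.prodMk (continuous_snd.add continuous_const))
  continuous_uncurry_partialDeriv₂ i j := by
    have e : (uncurry fun t y => FunctionSpaces.Torus.partialDeriv i (FunctionSpaces.Torus.partialDeriv j (fun y => ψ t (y + a))) y)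
        = (uncurry fun t y => FunctionSpaces.Torus.partialDeriv i (FunctionSpaces.Torus.partialDeriv j (ψ t)) y)
          ∘ fun p : ℝ × UnitAddTorus d => (p.1, p.2 + a) := by
      funext p
      simp only [uncurry, Function.comp_apply, FunctionSpaces.Torus.partialDeriv_translate', FunctionSpaces.Torus.partialDeriv_translate]
    rw [e]
    exact (hψ.continuous_uncurry_partialDeriv₂ i j).comp (continuous_fst.prodMk (continuous_snd.add continuous_const))
  continuous_uncurry_iterPartialDeriv l := by
    have e : (uncurry fun t y => FunctionSpaces.Torus.iterPartialDeriv l (fun y => ψ t (y + a)) y)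
        = (uncurry fun t y => FunctionSpaces.Torus.iterPartialDeriv l (ψ t) y) ∘ fun p : ℝ × UnitAddTorus d => (p.1, p.2 + a) := by
      funext p; simp only [uncurry, Function.comp_apply, FunctionSpaces.Torus.iterPartialDeriv_translate]
    rw [e]
    exact (hψ.continuous_uncurry_iterPartialDeriv l).comp (continuous_fst.prodMk (continuous_snd.add continuous_const))
  lipschitz := by
    obtain ⟨L, hL0, hL⟩ := hψ.lipschitz
    exact ⟨L, hL0, fun t ht s hs y => hL t ht s hs (y + a)⟩
  eventually_zero := by
    obtain ⟨T', hT', hz⟩ := hψ.eventually_zero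
    refine ⟨T', hT', fun t ht => ?_⟩
    funext y
    simp only [hz t ht, Pi.zero_apply]

/-- The constant-coefficient divergence-form test operator commutes with translations:
`viscAdjVar (· ↦ 𝔹) (Ψ(· + a)) x = viscAdjVar (· ↦ 𝔹) Ψ (x + a)` for space-smooth `Ψ`. [cite: Frisch1995Turbulence, §9.6.3 eq. (9.57) p. 233] -/
theorem viscAdjVar_const_translate (𝔹 : Visc4 d) {Ψ : UnitAddTorus d → EuclideanSpace ℝ d} (hΨ : FunctionSpaces.Torus.IsSmooth Ψ)
    (a x : UnitAddTorus d) :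
    viscAdjVar (fun _ => 𝔹) (fun y => Ψ (y + a)) x = viscAdjVar (fun _ => 𝔹) Ψ (x + a) := by
  rw [viscAdjVar_const 𝔹 (hΨ.comp_add_right a) x, viscAdjVar_const 𝔹 hΨ (x + a), viscAdj_translate]

/-! ## §3 Translation covariance of the constant-frame class -/

namespace IsWeakTensorPassiveVectorDistortedOn

variable {A T : ℝ} {𝔸 : Visc4 d} {b w : ℝ → UnitAddTorus d → EuclideanSpace ℝ d}
  {G₀ : Matrix d d ℝ} {w₀ : UnitAddTorus d → EuclideanSpace ℝ d}

/-- **Translation covariance of constant-frame distorted weak solutions.**  If `w` is a weak solution of the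
`G₀`-distorted passive-vector problem on `T^d × [0,T)` along `b` from `w₀` (`G₀` a CONSTANT frame), then for every
`a ∈ T^d` the translate `(t, y) ↦ w t (y + a)` is one along `(t, y) ↦ b t (y + a)` from `y ↦ w₀ (y + a)`:
translation invariance of the Haar measure, the constant frame and the constant conjugated tensor commute with
translations, and the time-Lipschitz test class is translation invariant (test the original identity against
`Ψ(·, · − a)`). [cite: DiPernaLions1989, §II.1 (12)–(14)] [cite: ArmstrongVicol2025, §4.1 (PDF p. 34)] -/
theorem translate_constFrame (h : IsWeakTensorPassiveVectorDistortedOn A T 𝔸 b (fun _ _ => G₀) w₀ w) (a : UnitAddTorus d) :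
    IsWeakTensorPassiveVectorDistortedOn A T 𝔸 (fun t x => b t (x + a)) (fun _ _ => G₀) (fun x => w₀ (x + a)) (fun t x => w t (x + a)) where
  aestronglyMeasurable := by
    rw [FunctionSpaces.Torus.stLift_translate]
    exact h.aestronglyMeasurable.comp_measurePreserving
      (FunctionSpaces.Torus.measurePreserving_prod_add_right measurableSet_Ioo _)
  aestronglyMeasurable_carrier := by
    rw [FunctionSpaces.Torus.stLift_translate]
    exact h.aestronglyMeasurable_carrier.comp_measurePreserving
      (FunctionSpaces.Torus.measurePreserving_prod_add_right measurableSet_Ioo _)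
  ae_lintegral_sq_le := by
    obtain ⟨C, hC⟩ := h.ae_lintegral_sq_le
    refine ⟨C, ?_⟩
    filter_upwards [hC] with t ht
    rwa [lintegral_add_right_eq_self (μ := (volume : Measure (UnitAddTorus d))) (fun x => ‖w t x‖ₑ ^ 2) a]
  lintegral_carrier_lt_top := by
    have e : ∀ t, ∫⁻ x, ‖b t (x + a)‖ₑ ^ 2 = ∫⁻ x, ‖b t x‖ₑ ^ 2 := fun t =>
      lintegral_add_right_eq_self (μ := (volume : Measure (UnitAddTorus d))) (fun x => ‖b t x‖ₑ ^ 2) a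
    simp_rw [e]
    exact h.lintegral_carrier_lt_top
  lintegral_mul_lt_top := by
    have e : ∀ t, ∫⁻ x, ‖b t (x + a)‖ₑ * ‖w t (x + a)‖ₑ = ∫⁻ x, ‖b t x‖ₑ * ‖w t x‖ₑ := fun t =>
      lintegral_add_right_eq_self (μ := (volume : Measure (UnitAddTorus d))) (fun x => ‖b t x‖ₑ * ‖w t x‖ₑ) a
    simp_rw [e]
    exact h.lintegral_mul_lt_top
  ae_isWeaklyDivFree_carrier := by
    filter_upwards [h.ae_isWeaklyDivFree_carrier] with t ht
    exact ht.translate a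
  ae_isWeaklyDivFree_distort := by
    filter_upwards [h.ae_isWeaklyDivFree_distort] with t ht
    have e : distort ((fun (_ : ℝ) (_ : UnitAddTorus d) => G₀) t) (fun x => w t (x + a))
        = fun y => distort (fun _ : UnitAddTorus d => G₀) (w t) (y + a) := distort_const_translate G₀ (w t) a
    rw [e]
    exact ht.translate a
  weak_eq Ψ hΨ hΨdiv := by
    -- test the original identity against the back-translated field `Ψ' t x = Ψ t (x - a)`
    set Ψ' : ℝ → UnitAddTorus d → EuclideanSpace ℝ d := fun t x => Ψ t (x + -a) with hΨ'_def
    have hΨ' : IsLipschitzSpaceTimeTest T Ψ' := hΨ.translate (-a)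
    have hΨ'div : ∀ t, FunctionSpaces.Torus.IsDivFree (distort ((fun (_ : ℝ) (_ : UnitAddTorus d) => G₀) t) (Ψ' t)) := by
      intro t
      have e : distort ((fun (_ : ℝ) (_ : UnitAddTorus d) => G₀) t) (Ψ' t)
          = fun y => distort (fun _ : UnitAddTorus d => G₀) (Ψ t) (y + -a) := distort_const_translate G₀ (Ψ t) (-a)
      rw [e]
      exact (hΨdiv t).translate (-a)
    have key := h.weak_eq Ψ' hΨ' hΨ'div
    -- translate every space integral by `a`
    have hsp : ∀ t, (∫ x, (⟪w t x, FunctionSpaces.Torus.timeDeriv Ψ' t x +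
          FunctionSpaces.Torus.convect (b t) (Ψ' t) x + viscAdjVar (fun y => Visc4.conj ((fun (_ : ℝ) (_ : UnitAddTorus d) => G₀) t y) 𝔸) (Ψ' t) x⟫_ℝ +
        A * ⟪b t x, FunctionSpaces.Torus.convect (w t) (Ψ' t) x⟫_ℝ)) =
        ∫ x, (⟪w t (x + a), FunctionSpaces.Torus.timeDeriv Ψ t x +
          FunctionSpaces.Torus.convect (fun y => b t (y + a)) (Ψ t) x
            + viscAdjVar (fun y => Visc4.conj ((fun (_ : ℝ) (_ : UnitAddTorus d) => G₀) t y) 𝔸) (Ψ t) x⟫_ℝ +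
        A * ⟪b t (x + a), FunctionSpaces.Torus.convect (fun y => w t (y + a)) (Ψ t) x⟫_ℝ) := by
      intro t
      rw [← integral_add_right_eq_self _ a]
      refine integral_congr_ae (Eventually.of_forall fun x => ?_)
      have e1 : FunctionSpaces.Torus.timeDeriv Ψ' t (x + a) = FunctionSpaces.Torus.timeDeriv Ψ t x := by
        rw [hΨ'_def, FunctionSpaces.Torus.timeDeriv_translate, add_neg_cancel_right]
      have e2 : FunctionSpaces.Torus.convect (b t) (Ψ' t) (x + a) =
          FunctionSpaces.Torus.convect (fun y => b t (y + a)) (Ψ t) x := by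
        simp only [hΨ'_def, FunctionSpaces.Torus.convect]
        rw [FunctionSpaces.Torus.fderiv_translate, add_neg_cancel_right]
      have e3 : viscAdjVar (fun y => Visc4.conj ((fun (_ : ℝ) (_ : UnitAddTorus d) => G₀) t y) 𝔸) (Ψ' t) (x + a)
          = viscAdjVar (fun y => Visc4.conj ((fun (_ : ℝ) (_ : UnitAddTorus d) => G₀) t y) 𝔸) (Ψ t) x := by
        show viscAdjVar (fun _ => Visc4.conj G₀ 𝔸) (fun y => Ψ t (y + -a)) (x + a) = viscAdjVar (fun _ => Visc4.conj G₀ 𝔸) (Ψ t) x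
        rw [viscAdjVar_const_translate (Visc4.conj G₀ 𝔸) (hΨ.isSmooth_slice t) (-a) (x + a), add_neg_cancel_right]
      have e4 : FunctionSpaces.Torus.convect (w t) (Ψ' t) (x + a) =
          FunctionSpaces.Torus.convect (fun y => w t (y + a)) (Ψ t) x := by
        simp only [hΨ'_def, FunctionSpaces.Torus.convect]
        rw [FunctionSpaces.Torus.fderiv_translate, add_neg_cancel_right]
      simp only [e1, e2, e3, e4]
    have hd : ∫ x, ⟪w₀ x, Ψ' 0 x⟫_ℝ = ∫ x, ⟪w₀ (x + a), Ψ 0 x⟫_ℝ := by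
      rw [← integral_add_right_eq_self _ a]
      refine integral_congr_ae (Eventually.of_forall fun x => ?_)
      simp only [hΨ'_def, add_neg_cancel_right]
    simp_rw [hsp] at key
    rw [hd] at key
    exact key

end IsWeakTensorPassiveVectorDistortedOn

end Torus

end Literature.Analysis.FluidPDE

end
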